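/-
Copyright (c) 2026 The decomp-a2c cell. All rights reserved.
Released under Apache 2.0 license as described in the file LICENSE.
-/
import Summits.AtomisticToContinuum.Crystallization.Theorems.ChartedZeroExcessLayeredLatticeLiouvilleWR

/-!
# ChartedZeroExcessLayeredLatticeLiouville — part WS «FarBand»: the block operator of a proportional window equals the chain flux up to a
  FAR-BAND correction that decays like `R⁻²` (linear class) and `s⁻³` (bounded class)
  (decomp-a2c-lens-2, g58; helper of stmt-AtomisticToContinuum-26636, leaf (PC) `ProfileComparisonAt`; step §3(ii) of memo NODE-g58d as amended by
  critic row 1007 (iv))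

The window inverse of part WB (`increment_le_local`) controls an increment `Δ k₀` of a profile by `H ≥ max_{n ∈ W} ‖blockApply (fluxBlock) T_w Δ n‖`
on the window `W = [k₀ − R, k₀ + R]` with the block carrier `T_w = [k₀ − 2R, k₀ + 2R]`.  The data we control (parts WQ, WR) is the CHAIN FLUX
`chainFlux T d n` of the profile difference; the two differ by the blocks reaching out of `T_w`:

* `blockApply_fluxBlock_eq` — `blockApply (fluxBlock) T_w Δ n = chainFlux T d n − Σ_{k ∈ band(n) ∖ T_w} fluxBlock n k (Δ k)` (`Δ k = d(k+1) − d k`; VP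
  `chainFlux_eq_sum_fluxBlock`, blocks vanish off the band `[n − ⌊ϱ/c⌋₊, n + ⌊ϱ/c⌋₊]`);
* `norm_sum_fluxBlock_apply_le_wt` — the far blocks weighted by the VR decay `bandWt n k = (|n − k| + 1)⁻⁴` (`norm_fluxBlock_le_decay`);
* `sum_bandWt_le_of_far` (`Σ_{|n−k| ≥ s} bandWt ≤ 7 s⁻³`, VR `sum_inv_max_pow_four_le`), `sum_bandWt_linear_le`
  (`Σ_{|n−k| ≥ R+1} bandWt·(|n − k| + 2R) ≤ 12 (R+1)⁻²`,
  VR `sum_inv_sq_le_of_injOn` on the two sides of `n`), `natAbs_ge_of_far` (`n ∈ W`, `k ∉ T_w` ⇒ `|n − k| ≥ R + 1`);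
* ★★ `norm_blockApply_far_le` — for `n ∈ W`: if every far increment is EITHER in the linear class `‖Δ k‖ ≤ θ·(|n − k| + 2R)` (the bootstrap ratio) OR in
  the bounded class `|n − k| ≥ s ∧ ‖Δ k‖ ≤ B` (the a-priori bound beyond the bootstrap range), then
  `‖blockApply (fluxBlock) T_w Δ n‖ ≤ H₀ + 196·K·(12·θ·(R+1)⁻² + 7·B·s⁻³)` whenever `‖chainFlux T d n‖ ≤ H₀`.

Every constant is `ϱ`-free; `⌊ϱ/c⌋₊` enters only through the finiteness of the band.  This is the far-band split that replaces the dead end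
`T_w = band(W)` (NODE-g58d §3); the bootstrap algebra (maximiser over `I₆₄`, critic row 1007 (iii)(iv)) is the next part.
-/

namespace Summit.AtomisticToContinuum.Crystallization.Theorems.ChartedZeroExcessLayeredLatticeLiouville

open Summit.AtomisticToContinuum.Crystallization.Theorems.ChartedPlanarOrderRigidityDoor (E3)
open Finset
open scoped InnerProductSpace RealInnerProductSpace BigOperators

noncomputable section FarBand

variable {c : ℝ} {a b : E3} {w : ℤ → E3}

/-! ### WS.1  The block operator of a window versus the chain flux -/

/-- the block operator of ANY finite block carrier `T_w` applied to the increments of a profile `d` at layer `n` equals the chain flux of `d` through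
gap `n` (over any kernel carrier `T` containing the band box) minus the blocks of the band of `n` that reach out of `T_w`. [this file, g58] -/
theorem blockApply_fluxBlock_eq (hc : 0 < c) (hL : IsLayeredCrystal c a b w) {ϱ : ℝ} (Tw : Finset ℤ) (d : ℤ → E3) {T : Finset ℤ} {n : ℤ}
    (hT : Icc (n - ⌊ϱ / c⌋₊) (n + 1 + ⌊ϱ / c⌋₊) ⊆ T) :
    blockApply (fluxBlock hc hL ϱ) Tw (fun k => d (k + 1) - d k) n =
      chainFlux ϱ a b w T d n - ∑ k ∈ Icc (n - ⌊ϱ / c⌋₊) (n + ⌊ϱ / c⌋₊) \ Tw, fluxBlock hc hL ϱ n k (d (k + 1) - d k) := by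
  rw [chainFlux_eq_sum_fluxBlock hc hL d hT]
  dsimp only [blockApply]
  have hvan : ∀ k ∈ Tw \ Icc (n - ⌊ϱ / c⌋₊) (n + ⌊ϱ / c⌋₊), fluxBlock hc hL ϱ n k (d (k + 1) - d k) = 0 := fun k hk => by
    rw [fluxBlock_eq_zero_of_not_mem hc hL ϱ (mem_sdiff.mp hk).2, zero_apply]
  have h1 : ∑ k ∈ Tw, fluxBlock hc hL ϱ n k (d (k + 1) - d k) =
      ∑ k ∈ Tw ∩ Icc (n - ⌊ϱ / c⌋₊) (n + ⌊ϱ / c⌋₊), fluxBlock hc hL ϱ n k (d (k + 1) - d k) := by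
    rw [← Finset.sum_inter_add_sum_sdiff Tw (Icc (n - ⌊ϱ / c⌋₊) (n + ⌊ϱ / c⌋₊)) (fun k => fluxBlock hc hL ϱ n k (d (k + 1) - d k)),
      sum_eq_zero hvan, add_zero]
  have h2 := Finset.sum_inter_add_sum_sdiff (Icc (n - ⌊ϱ / c⌋₊) (n + ⌊ϱ / c⌋₊)) Tw (fun k => fluxBlock hc hL ϱ n k (d (k + 1) - d k))
  rw [h1, inter_comm, ← h2, add_sub_cancel_right]

/-- the far blocks under the VR decay: `‖Σ_{k ∈ P} fluxBlock n k (Δ k)‖ ≤ 196·K·Σ_{k ∈ P} bandWt n k·‖Δ k‖` (weighted form of WB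
`norm_sum_fluxBlock_apply_le`).
[formal bookkeeping] -/
theorem norm_sum_fluxBlock_apply_le_wt (hc : 0 < c) (hL : IsLayeredCrystal c a b w) (ϱ : ℝ) (P : Finset ℤ) (Δ : ℤ → E3) (n : ℤ) :
    ‖∑ k ∈ P, fluxBlock hc hL ϱ n k (Δ k)‖ ≤ 196 * kernelConst c * ∑ k ∈ P, bandWt n k * ‖Δ k‖ := by
  calc ‖∑ k ∈ P, fluxBlock hc hL ϱ n k (Δ k)‖ ≤ ∑ k ∈ P, ‖fluxBlock hc hL ϱ n k (Δ k)‖ := norm_sum_le _ _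
    _ ≤ ∑ k ∈ P, 196 * kernelConst c * (bandWt n k * ‖Δ k‖) := sum_le_sum fun k _ => by
        have hdec : ‖fluxBlock hc hL ϱ n k‖ ≤ 196 * kernelConst c * bandWt n k := norm_fluxBlock_le_decay hc hL ϱ n k
        calc ‖fluxBlock hc hL ϱ n k (Δ k)‖ ≤ ‖fluxBlock hc hL ϱ n k‖ * ‖Δ k‖ := ContinuousLinearMap.le_opNorm _ _
          _ ≤ 196 * kernelConst c * bandWt n k * ‖Δ k‖ := mul_le_mul_of_nonneg_right hdec (norm_nonneg _)
          _ = 196 * kernelConst c * (bandWt n k * ‖Δ k‖) := by ring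
    _ = 196 * kernelConst c * ∑ k ∈ P, bandWt n k * ‖Δ k‖ := by rw [← mul_sum]

/-! ### WS.2  The two decay sums -/

/-- the BOUNDED-class decay sum: over layers `k` at distance `≥ s ≥ 1` from `n`, `Σ bandWt n k ≤ 7·s⁻³` (VR `sum_inv_max_pow_four_le` after the reflection
`k ↦ n − k`). [this file, g58] -/
theorem sum_bandWt_le_of_far (n : ℤ) (P : Finset ℤ) {s : ℕ} (hs : 1 ≤ s) (hP : ∀ k ∈ P, s ≤ (n - k).natAbs) :
    ∑ k ∈ P, bandWt n k ≤ 7 * (((s : ℕ) : ℝ)⁻¹) ^ 3 := by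
  have hs1 : (1 : ℝ) ≤ s := by exact_mod_cast hs
  have hterm : ∀ k ∈ P, bandWt n k ≤ ((max ((((n - k).natAbs : ℕ)) : ℝ) ((s : ℕ) : ℝ))⁻¹) ^ 4 := by
    intro k hk
    have hsk : ((s : ℕ) : ℝ) ≤ (((n - k).natAbs : ℕ) : ℝ) := by exact_mod_cast hP k hk
    have ht0 : (0 : ℝ) < (((n - k).natAbs : ℕ) : ℝ) := by linarith
    rw [max_eq_left hsk]
    unfold bandWt
    exact pow_le_pow_left₀ (inv_nonneg.mpr (by positivity)) (inv_anti₀ ht0 (by linarith)) 4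
  have hinj : ∀ x ∈ P, ∀ y ∈ P, n - x = n - y → x = y := fun x _ y _ h => by omega
  calc ∑ k ∈ P, bandWt n k ≤ ∑ k ∈ P, ((max ((((n - k).natAbs : ℕ)) : ℝ) ((s : ℕ) : ℝ))⁻¹) ^ 4 := sum_le_sum hterm
    _ = ∑ x ∈ P.image (fun k => n - k), ((max (((x.natAbs : ℕ)) : ℝ) ((s : ℕ) : ℝ))⁻¹) ^ 4 := by rw [sum_image hinj]
    _ ≤ 7 * (((s : ℕ) : ℝ)⁻¹) ^ 3 := sum_inv_max_pow_four_le _ hs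

/-- the LINEAR-class decay sum: over layers `k` at distance `≥ R + 1` from `n`, `Σ bandWt n k·(|n − k| + 2R) ≤ 12·(R+1)⁻²` (per term `≤ 3(R+1)⁻¹·|n−k|⁻²`,
then VR `sum_inv_sq_le_of_injOn` on each side of `n`). [this file, g58] -/
theorem sum_bandWt_linear_le (n : ℤ) (P : Finset ℤ) {R : ℕ} (hP : ∀ k ∈ P, R + 1 ≤ (n - k).natAbs) :
    ∑ k ∈ P, bandWt n k * (((((n - k).natAbs : ℕ)) : ℝ) + 2 * R) ≤ 12 * (((((R : ℕ) : ℝ)) + 1)⁻¹) ^ 2 := by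
  have hR0 : (0 : ℝ) ≤ R := Nat.cast_nonneg R
  have hterm : ∀ k ∈ P, bandWt n k * (((((n - k).natAbs : ℕ)) : ℝ) + 2 * R) ≤ 3 * ((((R : ℕ) : ℝ)) + 1)⁻¹ * (((((n - k).natAbs : ℕ)) : ℝ) ^ 2)⁻¹ := by
    intro k hk
    have ht : ((R : ℕ) : ℝ) + 1 ≤ (((n - k).natAbs : ℕ) : ℝ) := by exact_mod_cast hP k hk
    have ht0 : (0 : ℝ) < (((n - k).natAbs : ℕ) : ℝ) := by linarith
    unfold bandWt
    rw [show 3 * ((((R : ℕ) : ℝ)) + 1)⁻¹ * (((((n - k).natAbs : ℕ)) : ℝ) ^ 2)⁻¹ = 3 / (((((R : ℕ) : ℝ)) + 1) * ((((n - k).natAbs : ℕ)) : ℝ) ^ 2) by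
        rw [div_eq_mul_inv, mul_inv, mul_assoc],
      le_div_iff₀ (by positivity), inv_pow, ← one_div, div_mul_eq_mul_div, div_mul_eq_mul_div, div_le_iff₀ (by positivity), one_mul]
    calc (((((n - k).natAbs : ℕ)) : ℝ) + 2 * R) * ((((R : ℕ) : ℝ) + 1) * ((((n - k).natAbs : ℕ)) : ℝ) ^ 2)
        ≤ (3 * ((((n - k).natAbs : ℕ)) : ℝ)) * (((((n - k).natAbs : ℕ)) : ℝ) * ((((n - k).natAbs : ℕ)) : ℝ) ^ 2) :=
          mul_le_mul (by linarith) (mul_le_mul_of_nonneg_right ht (sq_nonneg _)) (by positivity) (by positivity)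
      _ = 3 * ((((n - k).natAbs : ℕ)) : ℝ) ^ 4 := by ring
      _ ≤ 3 * (((((n - k).natAbs : ℕ)) : ℝ) + 1) ^ 4 := by gcongr; linarith
  have hinj₁ : Set.InjOn (fun k : ℤ => (n - k).natAbs) ↑(P.filter fun k : ℤ => k < n) := by
    intro x hx y hy hxy
    have hx' := (mem_filter.mp (mem_coe.mp hx)).2
    have hy' := (mem_filter.mp (mem_coe.mp hy)).2
    have h' : (n - x).natAbs = (n - y).natAbs := hxy
    omega
  have hinj₂ : Set.InjOn (fun k : ℤ => (n - k).natAbs) ↑(P.filter fun k : ℤ => ¬ k < n) := by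
    intro x hx y hy hxy
    have hx' := (mem_filter.mp (mem_coe.mp hx)).2
    have hy' := (mem_filter.mp (mem_coe.mp hy)).2
    have h' : (n - x).natAbs = (n - y).natAbs := hxy
    omega
  have h₁ : ∑ k ∈ P with k < n, (((((n - k).natAbs : ℕ)) : ℝ) ^ 2)⁻¹ ≤ 2 / (((R : ℕ) : ℝ) + 1) :=
    sum_inv_sq_le_of_injOn (fun k : ℤ => (n - k).natAbs) hinj₁ fun k hk => by have := hP k (mem_filter.mp hk).1; omega
  have h₂ : ∑ k ∈ P with ¬ k < n, (((((n - k).natAbs : ℕ)) : ℝ) ^ 2)⁻¹ ≤ 2 / (((R : ℕ) : ℝ) + 1) :=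
    sum_inv_sq_le_of_injOn (fun k : ℤ => (n - k).natAbs) hinj₂ fun k hk => by have := hP k (mem_filter.mp hk).1; omega
  have hsum : ∑ k ∈ P, (((((n - k).natAbs : ℕ)) : ℝ) ^ 2)⁻¹ ≤ 4 * ((((R : ℕ) : ℝ)) + 1)⁻¹ := by
    rw [← sum_filter_add_sum_filter_not P (fun k : ℤ => k < n)]
    have e : 2 / (((R : ℕ) : ℝ) + 1) = 2 * ((((R : ℕ) : ℝ)) + 1)⁻¹ := div_eq_mul_inv _ _
    linarith
  calc ∑ k ∈ P, bandWt n k * (((((n - k).natAbs : ℕ)) : ℝ) + 2 * R)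
      ≤ ∑ k ∈ P, 3 * ((((R : ℕ) : ℝ)) + 1)⁻¹ * (((((n - k).natAbs : ℕ)) : ℝ) ^ 2)⁻¹ := sum_le_sum hterm
    _ = 3 * ((((R : ℕ) : ℝ)) + 1)⁻¹ * ∑ k ∈ P, (((((n - k).natAbs : ℕ)) : ℝ) ^ 2)⁻¹ := by rw [← mul_sum]
    _ ≤ 3 * ((((R : ℕ) : ℝ)) + 1)⁻¹ * (4 * ((((R : ℕ) : ℝ)) + 1)⁻¹) := mul_le_mul_of_nonneg_left hsum (by positivity)
    _ = 12 * (((((R : ℕ) : ℝ)) + 1)⁻¹) ^ 2 := by ring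

/-- window geometry: a layer `n` of the inner window `[k₀ − R, k₀ + R]` and a layer `k` outside the block carrier `[k₀ − 2R, k₀ + 2R]` are at distance
`≥ R + 1`. [formal bookkeeping] -/
theorem natAbs_ge_of_far {k₀ n k : ℤ} {R : ℕ} (hn : n ∈ Icc (k₀ - R) (k₀ + R)) (hk : k ∉ Icc (k₀ - 2 * R) (k₀ + 2 * R)) :
    R + 1 ≤ (n - k).natAbs := by
  rw [mem_Icc] at hn
  rw [mem_Icc, not_and_or, not_le, not_le] at hk
  omega

/-! ### WS.3  The far-band bound for the block operator of a proportional window -/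

/-- ★★ THE FAR-BAND BOUND: on the inner window `n ∈ [k₀ − R, k₀ + R]` with block carrier `T_w = [k₀ − 2R, k₀ + 2R]`, if the chain flux of the profile `d`
through gap `n` is `≤ H₀` and every increment of the band of `n` outside `T_w` is either in the LINEAR class `‖Δ k‖ ≤ θ(|n − k| + 2R)` or in the BOUNDED class
`|n − k| ≥ s ∧ ‖Δ k‖ ≤ B`, then `‖blockApply (fluxBlock) T_w Δ n‖ ≤ H₀ + 196·K·(12θ(R+1)⁻² + 7B s⁻³)` — the `H` of WB `increment_le_local`,
`ϱ`-free.
[this file, g58] -/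
theorem norm_blockApply_far_le (hc : 0 < c) (hL : IsLayeredCrystal c a b w) {ϱ : ℝ} (d : ℤ → E3) {T : Finset ℤ} {k₀ n : ℤ} {R s : ℕ} (hs : 1 ≤ s)
    (hn : n ∈ Icc (k₀ - R) (k₀ + R)) (hT : Icc (n - ⌊ϱ / c⌋₊) (n + 1 + ⌊ϱ / c⌋₊) ⊆ T) {H₀ θ B : ℝ} (hθ : 0 ≤ θ) (hB : 0 ≤ B)
    (hH₀ : ‖chainFlux ϱ a b w T d n‖ ≤ H₀)
    (hΔ : ∀ k ∈ Icc (n - ⌊ϱ / c⌋₊) (n + ⌊ϱ / c⌋₊), k ∉ Icc (k₀ - 2 * R) (k₀ + 2 * R) →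
      ‖d (k + 1) - d k‖ ≤ θ * (((((n - k).natAbs : ℕ)) : ℝ) + 2 * R) ∨ (s ≤ (n - k).natAbs ∧ ‖d (k + 1) - d k‖ ≤ B)) :
    ‖blockApply (fluxBlock hc hL ϱ) (Icc (k₀ - 2 * R) (k₀ + 2 * R)) (fun k => d (k + 1) - d k) n‖ ≤
      H₀ + 196 * kernelConst c * (12 * θ * (((((R : ℕ) : ℝ)) + 1)⁻¹) ^ 2 + 7 * B * (((s : ℕ) : ℝ)⁻¹) ^ 3) := by
  have hF := kernelConst_nonneg hc
  rw [blockApply_fluxBlock_eq hc hL _ d hT]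
  set P := Icc (n - ⌊ϱ / c⌋₊) (n + ⌊ϱ / c⌋₊) \ Icc (k₀ - 2 * R) (k₀ + 2 * R) with hP
  have hfar : ∀ k ∈ P, R + 1 ≤ (n - k).natAbs := fun k hk => natAbs_ge_of_far hn (mem_sdiff.mp hk).2
  have hcls : ∀ k ∈ P.filter (fun k => ¬ ‖d (k + 1) - d k‖ ≤ θ * (((((n - k).natAbs : ℕ)) : ℝ) + 2 * R)),
      s ≤ (n - k).natAbs ∧ ‖d (k + 1) - d k‖ ≤ B := fun k hk => by
    obtain ⟨hkP, hk⟩ := mem_filter.mp hk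
    exact (hΔ k (mem_sdiff.mp hkP).1 (mem_sdiff.mp hkP).2).resolve_left hk
  have hA : ∑ k ∈ P with ‖d (k + 1) - d k‖ ≤ θ * (((((n - k).natAbs : ℕ)) : ℝ) + 2 * R), bandWt n k * ‖d (k + 1) - d k‖ ≤
      θ * (12 * (((((R : ℕ) : ℝ)) + 1)⁻¹) ^ 2) := by
    calc ∑ k ∈ P with ‖d (k + 1) - d k‖ ≤ θ * (((((n - k).natAbs : ℕ)) : ℝ) + 2 * R), bandWt n k * ‖d (k + 1) - d k‖
        ≤ ∑ k ∈ P with ‖d (k + 1) - d k‖ ≤ θ * (((((n - k).natAbs : ℕ)) : ℝ) + 2 * R), θ * (bandWt n k * (((((n - k).natAbs : ℕ)) : ℝ) + 2 * R)) :=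
          sum_le_sum fun k hk => by
            calc bandWt n k * ‖d (k + 1) - d k‖ ≤ bandWt n k * (θ * (((((n - k).natAbs : ℕ)) : ℝ) + 2 * R)) :=
                  mul_le_mul_of_nonneg_left (mem_filter.mp hk).2 (bandWt_nonneg n k)
              _ = θ * (bandWt n k * (((((n - k).natAbs : ℕ)) : ℝ) + 2 * R)) := by ring
      _ = θ * ∑ k ∈ P with ‖d (k + 1) - d k‖ ≤ θ * (((((n - k).natAbs : ℕ)) : ℝ) + 2 * R), bandWt n k * (((((n - k).natAbs : ℕ)) : ℝ) + 2 * R) := by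
          rw [← mul_sum]
      _ ≤ θ * (12 * (((((R : ℕ) : ℝ)) + 1)⁻¹) ^ 2) :=
          mul_le_mul_of_nonneg_left (sum_bandWt_linear_le n _ fun k hk => hfar k (mem_filter.mp hk).1) hθ
  have hBd : ∑ k ∈ P with ¬ ‖d (k + 1) - d k‖ ≤ θ * (((((n - k).natAbs : ℕ)) : ℝ) + 2 * R), bandWt n k * ‖d (k + 1) - d k‖ ≤
      B * (7 * (((s : ℕ) : ℝ)⁻¹) ^ 3) := by
    calc ∑ k ∈ P with ¬ ‖d (k + 1) - d k‖ ≤ θ * (((((n - k).natAbs : ℕ)) : ℝ) + 2 * R), bandWt n k * ‖d (k + 1) - d k‖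
        ≤ ∑ k ∈ P with ¬ ‖d (k + 1) - d k‖ ≤ θ * (((((n - k).natAbs : ℕ)) : ℝ) + 2 * R), B * bandWt n k := sum_le_sum fun k hk => by
          calc bandWt n k * ‖d (k + 1) - d k‖ ≤ bandWt n k * B := mul_le_mul_of_nonneg_left (hcls k hk).2 (bandWt_nonneg n k)
            _ = B * bandWt n k := mul_comm _ _
      _ = B * ∑ k ∈ P with ¬ ‖d (k + 1) - d k‖ ≤ θ * (((((n - k).natAbs : ℕ)) : ℝ) + 2 * R), bandWt n k := by rw [← mul_sum]
      _ ≤ B * (7 * (((s : ℕ) : ℝ)⁻¹) ^ 3) := mul_le_mul_of_nonneg_left (sum_bandWt_le_of_far n _ hs fun k hk => (hcls k hk).1) hB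
  have hw : ∑ k ∈ P, bandWt n k * ‖d (k + 1) - d k‖ ≤ 12 * θ * (((((R : ℕ) : ℝ)) + 1)⁻¹) ^ 2 + 7 * B * (((s : ℕ) : ℝ)⁻¹) ^ 3 := by
    rw [← sum_filter_add_sum_filter_not P (fun k => ‖d (k + 1) - d k‖ ≤ θ * (((((n - k).natAbs : ℕ)) : ℝ) + 2 * R))]
    linarith
  have hsum := norm_sum_fluxBlock_apply_le_wt hc hL ϱ P (fun k => d (k + 1) - d k) n
  have h196 := mul_le_mul_of_nonneg_left hw (by positivity : (0 : ℝ) ≤ 196 * kernelConst c)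
  calc ‖chainFlux ϱ a b w T d n - ∑ k ∈ P, fluxBlock hc hL ϱ n k (d (k + 1) - d k)‖
      ≤ ‖chainFlux ϱ a b w T d n‖ + ‖∑ k ∈ P, fluxBlock hc hL ϱ n k (d (k + 1) - d k)‖ := norm_sub_le _ _
    _ ≤ H₀ + 196 * kernelConst c * ∑ k ∈ P, bandWt n k * ‖d (k + 1) - d k‖ := add_le_add hH₀ hsum
    _ ≤ H₀ + 196 * kernelConst c * (12 * θ * (((((R : ℕ) : ℝ)) + 1)⁻¹) ^ 2 + 7 * B * (((s : ℕ) : ℝ)⁻¹) ^ 3) := by linarith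

/-! ### WS.4  The closed statement of this part -/

/-- The content of part WS as one closed proposition: the block/chain-flux identity and the far-band bound. -/
def FarBandShape : Prop :=
  ∀ c : ℝ, ∀ hc : 0 < c, ∀ (a b : E3) (w : ℤ → E3), ∀ hL : IsLayeredCrystal c a b w, ∀ (ϱ : ℝ) (d : ℤ → E3) (T : Finset ℤ),
    (∀ (Tw : Finset ℤ) (n : ℤ), Icc (n - ⌊ϱ / c⌋₊) (n + 1 + ⌊ϱ / c⌋₊) ⊆ T →
      blockApply (fluxBlock hc hL ϱ) Tw (fun k => d (k + 1) - d k) n =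
        chainFlux ϱ a b w T d n - ∑ k ∈ Icc (n - ⌊ϱ / c⌋₊) (n + ⌊ϱ / c⌋₊) \ Tw, fluxBlock hc hL ϱ n k (d (k + 1) - d k)) ∧
    ∀ (k₀ n : ℤ) (R s : ℕ), 1 ≤ s → n ∈ Icc (k₀ - R) (k₀ + R) → Icc (n - ⌊ϱ / c⌋₊) (n + 1 + ⌊ϱ / c⌋₊) ⊆ T →
      ∀ H₀ θ B : ℝ, 0 ≤ θ → 0 ≤ B → ‖chainFlux ϱ a b w T d n‖ ≤ H₀ →
        (∀ k ∈ Icc (n - ⌊ϱ / c⌋₊) (n + ⌊ϱ / c⌋₊), k ∉ Icc (k₀ - 2 * R) (k₀ + 2 * R) →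
          ‖d (k + 1) - d k‖ ≤ θ * (((((n - k).natAbs : ℕ)) : ℝ) + 2 * R) ∨ (s ≤ (n - k).natAbs ∧ ‖d (k + 1) - d k‖ ≤ B)) →
        ‖blockApply (fluxBlock hc hL ϱ) (Icc (k₀ - 2 * R) (k₀ + 2 * R)) (fun k => d (k + 1) - d k) n‖ ≤
          H₀ + 196 * kernelConst c * (12 * θ * (((((R : ℕ) : ℝ)) + 1)⁻¹) ^ 2 + 7 * B * (((s : ℕ) : ℝ)⁻¹) ^ 3)

/-- WS holds. [this file, g58] -/
theorem farBandShape_holds : FarBandShape :=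
  fun _c hc _a _b _w hL _ϱ d _T => ⟨fun Tw _n hT => blockApply_fluxBlock_eq hc hL Tw d hT,
    fun _k₀ _n _R _s hs hn hT _H₀ _θ _B hθ hB hH₀ hΔ => norm_blockApply_far_le hc hL d hs hn hT hθ hB hH₀ hΔ⟩

end FarBand

end Summit.AtomisticToContinuum.Crystallization.Theorems.ChartedZeroExcessLayeredLatticeLiouville
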